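import Literature.MathematicalPhysics.QuantumFieldTheory.Balaban1983to89.Node00.Record12CarriersRecords

/-!
# NODE 00 (YM-PLAN Track A) — THE CARRIER-PINNED STAGE-12 RECORDS, II: `IsRecordOfRecord₁₂CB10YZWB8B12 → IsRecordOfRecord₁₂CB10YZWB8` (+ [B12 §§2–5], SAME datum SAME
# world) and `IsRecordOfRecord₁₂CB10YZWB8subB12` ([B8] over the SUB-INDEX; SAME-DATUM companion in `₁₂CB10YZW`; OLD ⇒ NEW from the full-family record) with the six pinned
# leaves and the N05 ∕ N07 ∕ N08 ∕ N09 faces BY NAME — g32's `Record11CarriersB12` §3 + `Record11CarriersB8Sub` §3 restated at def-T's `Record12` (sequel of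
# `Node00/Record12CarriersRecords`)

NODE 00 RECORD MODULE (seat `pub-ymgap-node00-def` g32, 2026-08-26; director-ym R134 (c) t4; lead R457 repair lane ₁₂).  APPEND-ONLY: a NEW importing module; everything it
reads is CONSUMED BY NAME.  ref-C g18 READ116's located condition (B8) carries over VERBATIM to ₁₂ and is SAID here: the [B12] residual `lam12` (letters `K`, `A₂`, class `A331`,
constants) is DATA WITHOUT LAW and the datum does not read it (`datumOfRecord₁₂_pinB12 : rfl`), so the ∀-form «∀ (D, w) of `IsRecordOfRecord₁₂CB10YZWB8B12`, `Dag.B12_main`» is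
FALSE-OR-VACUOUS as typed and the ∃-form is a costume (`K = A₂ = 0`); N09's conjunct 1 is booked only at a record whose [B12] layer carries the by-reference package as DISPLAYED
hypotheses (node00-def-B12's `CarriersB12Package` faces) or as proviso fields of a successor record — not by these predicates alone.  [Balaban1987RG1] = Commun. Math. Phys.
**109** (1987) 249–301; [Balaban1985RegularSpaces] = Commun. Math. Phys. **99** (1985) 75–102; [Balaban1989LargeFieldII] = Commun. Math. Phys. **122** (1989) 355–392.

WHAT IS DEFINED ∕ PROVED (kernel bookkeeping, 0 sorry).  §3a **`IsRecordOfRecord₁₂CB10YZWB8B12`**, `exists_world_…`, **`isRecordOfRecord₁₂CB10YZWB8_of_…`** (SAME D, SAME w,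
witness `θ.pinB12 lam12`), `exists_isRecordOfRecord₁₂C_of_…`, `leaves_iff_of_…` (six), `leaf_b12_iff_of_…`, `b12_leaf_of_…_of_slots`, `unitPair_mem_Uprime_of_provisos₁₂` (the
printed domain is non-empty at a record: `Provisos₁₂.rzLaws`), `…_rebind_of_isRecordOfRecord₁₂C`.  §3b **`IsRecordOfRecord₁₂CB10YZWB8subB12`**, `exists_world_…`,
**`companion_of_…`** (same D∕C∕γ∕L in `₁₂CB10YZW`, witness `(θ.pinB12 lam12).pinB8Sub lam`; companion b8 typed-over-the-sub-family ⇒ record b8 surviving-over-the-sub-family),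
`exists_isRecordOfRecord₁₂C_of_…`, `leaves_iff_of_…`, `b4_b5_b6_b7_of_…`, `b8_b11_b10_main_iff_of_…`, `nodes_iff_bundles_of_…`, `b8_main_of_…_of_slots`,
`b12_leaf_of_…_of_slots`, `…_rebind_of_isRecordOfRecord₁₂C`, **`exists_isRecordOfRecord₁₂CB10YZWB8subB12_of_isRecordOfRecord₁₂CB10YZWB8B12`** (OLD ⇒ NEW at the record).
HONEST FRAMING: definitions + kernel bookkeeping; NO estimate; nothing of Bałaban's asserted; N05 ∕ N07 ∕ N08 ∕ N09 NOT discharged; counts unmoved (5∕28); one finite T⁴ programme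
at fixed ε — NOT continuum ∕ ℝ⁴ ∕ infinite volume ∕ OS ∕ mass gap ∕ Clay.  No `sorry`, no `axiom`, no `opaque`, no `instance`, no `notation`. -/

noncomputable section

namespace Literature.MathematicalPhysics.QuantumFieldTheory.Balaban1983to89.Node00

open T4Continuum AveragingRT T4FiniteEpsInhabited FlowStep FlowStepRuns DagBinding T4DatumAssembly
open B8LeafKnitRS (B8LeafRS)
open scoped Matrix.Norms.L2Operator

/-! ## §3a. `IsRecordOfRecord₁₂CB10YZWB8B12` — plus the [B12 §§2–5] pin; SAME datum, SAME world refinement of `IsRecordOfRecord₁₂CB10YZWB8` -/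

section Record12B12

variable (F : T4Family) (N : ℕ) [NeZero N]

/-- **«(D, w) is the record, Stage 12, all SIX typed carrier groups pinned, `b8` surviving»**: g31's `IsRecordOfRecord₁₂CB10YZWB8` VERBATIM except that the view is the six-pin
view, for SOME residual [B12] layer `lam12` (data quantified with the record's parameters; no law assumed).
[cite: Balaban1987RG1, Lemma 4 p.280; Balaban1985RegularSpaces, Lemma 1 – Thm 8 pp.79–101; Balaban1989LargeFieldII, Thm 1 + (0.1) pp.355–356 (objects of record)] -/
def IsRecordOfRecord₁₂CB10YZWB8B12 (D : FiniteEpsData F (SU N)) (w : WorldP) : Prop :=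
  ∃ (θ : Stage12Params F N) (h : θ.Provisos₁₂ F N) (lam12 : ResidB12 F N θ.τ9.M) (lam : ResidB8 θ.toStage3Params) (Mstar : ℕ) (ops : OpsY N θ.toStage3Params Mstar)
    (ζ : ResidZ F N) (lamW : ResidW F N),
    θ.Admissible F N ∧ D = datumOfRecord₁₂ F N θ h ∧ w.C = D.C ∧ (0 < w.γ ∧ w.γ ≤ θ.γ) ∧ w.L = (θ.L : ℝ) ∧
      ∀ P : B12.RunParams, w.up P = upOfRecord₅CS F N (θ.view₁₂B12B8B10YZW F N lam12 lam Mstar ops ζ lamW) P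

/-- Inhabitation is Stage 12's exactly (all six residual types inhabited). [cite: Balaban1989LargeFieldII, Thm 1 + (0.1) pp.355–356 (bookkeeping)] -/
theorem exists_world_isRecordOfRecord₁₂CB10YZWB8B12 (θ : Stage12Params F N) (h : θ.Provisos₁₂ F N) (hθ : θ.Admissible F N) (lam12 : ResidB12 F N θ.τ9.M)
    (lam : ResidB8 θ.toStage3Params) (Mstar : ℕ) (ops : OpsY N θ.toStage3Params Mstar) (ζ : ResidZ F N) (lamW : ResidW F N) {γw : ℝ} (hγw : 0 < γw ∧ γw ≤ θ.γ) :
    ∃ w : WorldP, IsRecordOfRecord₁₂CB10YZWB8B12 F N (datumOfRecord₁₂ F N θ h) w ∧ w.γ = γw := by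
  obtain ⟨w₀, -, -⟩ := exists_world_isRecordOfRecord₁₂C F N θ h hθ hγw
  exact ⟨{ w₀ with
      C := (datumOfRecord₁₂ F N θ h).C, γ := γw, L := (θ.L : ℝ), one_lt_L := by exact_mod_cast θ.hL.2,
      up := fun P => upOfRecord₅CS F N (θ.view₁₂B12B8B10YZW F N lam12 lam Mstar ops ζ lamW) P },
    ⟨θ, h, lam12, lam, Mstar, ops, ζ, lamW, hθ, rfl, rfl, hγw, rfl, fun _ => rfl⟩, rfl⟩

variable {F N}
variable {D : FiniteEpsData F (SU N)} {w : WorldP}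

/-- **Refinement `IsRecordOfRecord₁₂CB10YZWB8B12 → IsRecordOfRecord₁₂CB10YZWB8`** with THE SAME datum AND THE SAME world: witness the [B12]-pinned parameters `θ.pinB12 lam12`
(provisos transported field by field, datum `rfl` through `rebindX`, view by definition). [cite: Balaban1989LargeFieldII, Thm 1 + (0.1) pp.355–356 (bookkeeping)] -/
theorem isRecordOfRecord₁₂CB10YZWB8_of_isRecordOfRecord₁₂CB10YZWB8B12 (h : IsRecordOfRecord₁₂CB10YZWB8B12 F N D w) : IsRecordOfRecord₁₂CB10YZWB8 F N D w := by
  obtain ⟨θ, hP, lam12, lam, Mstar, ops, ζ, lamW, hθ, hD, hC, hγ, hL, hup⟩ := h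
  refine ⟨θ.pinB12 F N lam12, hP.pinB12 lam12, lam, Mstar, ops, ζ, lamW, (Stage12Params.pinB12_admissible_iff F N _ _).2 hθ, ?_, hC, hγ, hL, hup⟩
  rw [datumOfRecord₁₂_pinB12]
  exact hD

/-- … hence `→ IsRecordOfRecord₁₂C` through g31's companion-free chain is NOT available (the S-binding); what IS available with the same datum: g31's SAME-DATUM companion in
`IsRecordOfRecord₁₂CB10YZW` of the `…B8` refinement (`Record11CarriersB8.companion_of_isRecordOfRecord₁₂CB10YZWB8`), then `Record11Carriers.isRecordOfRecord₁₂C_of_…`.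
Here: the `₁₂C` record with the same datum at the companion world. [cite: Balaban1989LargeFieldII, Thm 1 + (0.1) pp.355–356 (bookkeeping)] -/
theorem exists_isRecordOfRecord₁₂C_of_isRecordOfRecord₁₂CB10YZWB8B12 (h : IsRecordOfRecord₁₂CB10YZWB8B12 F N D w) :
    ∃ w' : WorldP, IsRecordOfRecord₁₂C F N D w' ∧ w'.C = w.C ∧ w'.γ = w.γ ∧ w'.L = w.L ∧
      (∀ P : B12.RunParams, leavesP w P = { leavesP w' P with b8 := (leavesP w P).b8 }) := by
  obtain ⟨w', hw', hC, hγ, hL, hleaves, -⟩ := companion_of_isRecordOfRecord₁₂CB10YZWB8 (isRecordOfRecord₁₂CB10YZWB8_of_isRecordOfRecord₁₂CB10YZWB8B12 h)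
  exact ⟨w', isRecordOfRecord₁₂C_of_isRecordOfRecord₁₂CB10YZW hw', hC, hγ, hL, hleaves⟩

/-- **THE SIX PINNED LEAVES AT A RECORD OF THIS MODULE, for ONE parameter package**. [cite: Balaban1987RG1, Lemma 4 p.280; Balaban1985RegularSpaces, Lemma 1 – Thm 8 pp.79–101; Balaban1989LargeFieldI, Prop. 1 p.194; Balaban1985BackgroundPropagators, Thm 3.1 p.397; Balaban1985UV3, Thm 1 p.257; Balaban1985Variational, Thm 1 p.279] -/
theorem leaves_iff_of_isRecordOfRecord₁₂CB10YZWB8B12 (h : IsRecordOfRecord₁₂CB10YZWB8B12 F N D w) :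
    ∃ (θ : Stage12Params F N) (lam12 : ResidB12 F N θ.τ9.M) (lam : ResidB8 θ.toStage3Params) (Mstar : ℕ) (ops : OpsY N θ.toStage3Params Mstar) (ζ : ResidZ F N)
      (lamW : ResidW F N), θ.Admissible F N ∧ w.L = (θ.L : ℝ) ∧ ∀ P : B12.RunParams,
        ((leavesP w P).b12 ↔ B12LeafOfRecord₁₂ F N θ lam12 P) ∧ ((leavesP w P).b8 ↔ B8LeafOfRecord θ.toStage3Params lam) ∧
        ((leavesP w P).rBasicStep ↔ B15Leaf (WOfRecord₁₂ F N θ lamW P)) ∧ ((leavesP w P).b9 ↔ B9LeafX (Y9OfRecord N θ.toStage3Params Mstar ops)) ∧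
        ((leavesP w P).b10 ↔ PrintedUV3V N θ.L) ∧ ((leavesP w P).b11 ↔ B11Leaf (Z11OfRecord F N ζ)) := by
  obtain ⟨θ, -, lam12, lam, Mstar, ops, ζ, lamW, hθ, -, -, -, hL, hup⟩ := h
  refine ⟨θ, lam12, lam, Mstar, ops, ζ, lamW, hθ, hL, fun P => ?_⟩
  have hl := upOfRecord₅CS_view₁₂B12B8B10YZW_leaves F N θ lam12 lam Mstar ops ζ lamW P
  refine ⟨?_, ?_, ?_, ?_, ?_, ?_⟩
  · show (w.up P).b12 ↔ _
    rw [hup P]; exact hl.1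
  · show (w.up P).b8 ↔ _
    rw [hup P]; exact hl.2.1
  · show (w.up P).rBasicStep ↔ _
    rw [hup P]; exact hl.2.2.1
  · show (w.up P).b9 ↔ _
    rw [hup P]; exact hl.2.2.2.1
  · show (w.up P).b10 ↔ _
    rw [hup P]; exact hl.2.2.2.2.1
  · show (w.up P).b11 ↔ _
    rw [hup P]; exact hl.2.2.2.2.2

/-- **THE OWN LEAF OF N09's CONJUNCT 1 AT A RECORD OF THIS MODULE**: `b12` IS Lemma 4 at the group of record, for one parameter package.
[cite: Balaban1987RG1, Lemma 4 (3.53) p.280 (the leaf at the objects of record)] -/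
theorem leaf_b12_iff_of_isRecordOfRecord₁₂CB10YZWB8B12 (h : IsRecordOfRecord₁₂CB10YZWB8B12 F N D w) :
    ∃ (θ : Stage12Params F N) (lam12 : ResidB12 F N θ.τ9.M), θ.Admissible F N ∧ ∀ P : B12.RunParams, (leavesP w P).b12 ↔ B12LeafOfRecord₁₂ F N θ lam12 P := by
  obtain ⟨θ, lam12, _, _, _, _, _, hθ, -, hl⟩ := leaves_iff_of_isRecordOfRecord₁₂CB10YZWB8B12 h
  exact ⟨θ, lam12, hθ, fun P => (hl P).1⟩

/-- **N09's CONJUNCT 1 «SLOTS» FORM at a record of this module**: the leaf `b12` at every run from a closer at every presenting parameter package (a closer supplies the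
companion's face «displayed by-reference package ⇒ `B12LeafOfRecord₁₂`»). [cite: Balaban1987RG1, Lemma 4 (3.53) p.280 (the node's conjunct 1, bookkeeping)] -/
theorem b12_leaf_of_isRecordOfRecord₁₂CB10YZWB8B12_of_slots (h : IsRecordOfRecord₁₂CB10YZWB8B12 F N D w)
    (hB : ∀ (θ : Stage12Params F N) (hP : θ.Provisos₁₂ F N) (lam12 : ResidB12 F N θ.τ9.M) (lam : ResidB8 θ.toStage3Params) (Mstar : ℕ) (ops : OpsY N θ.toStage3Params Mstar)
      (ζ : ResidZ F N) (lamW : ResidW F N), θ.Admissible F N → D = datumOfRecord₁₂ F N θ hP →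
        (∀ P, w.up P = upOfRecord₅CS F N (θ.view₁₂B12B8B10YZW F N lam12 lam Mstar ops ζ lamW) P) → ∀ P, B12LeafOfRecord₁₂ F N θ lam12 P)
    (P : B12.RunParams) : (leavesP w P).b12 := by
  obtain ⟨θ, hP, lam12, lam, Mstar, ops, ζ, lamW, hθ, hD, -, -, -, hup⟩ := h
  show (w.up P).b12
  rw [hup P]
  exact (upOfRecord₅CS_view₁₂B12B8B10YZW_leaves F N θ lam12 lam Mstar ops ζ lamW P).1.2 (hB θ hP lam12 lam Mstar ops ζ lamW hθ hD hup P)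

/-- At a record of this module the upper space `U′ᶜ_{k+1}(□₀, a₀, a₁, α₀)` of the leaf is NON-EMPTY for positive radii: the unit pair `(1, 0)` lies in it (pub-balaban's
`unitPair_mem_space` at the frame of record under def-T's residual laws `Provisos₁₂.rzLaws`) — the leaf's `∀ 𝐔` is exercised. [cite: Balaban1987RG1, (1.11)–(1.16) p.262 (non-vacuity of the printed domain)] -/
theorem unitPair_mem_Uprime_of_provisos₁₂ (θ : Stage12Params F N) (hP : θ.Provisos₁₂ F N) (hθ : θ.Admissible F N) (lam12 : ResidB12 F N θ.τ9.M) (p : B12.RunParams)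
    {a₀ a₁ : ℝ} (h₀ : 0 < a₀) (h₁ : 0 < a₁) (hα₀ : 0 < (lam12 p).α₀) :
    B12RegularSpaces111Mono.unitPair ∈ (F12OfRecord₁₂ F N θ lam12 p).Uprime a₀ a₁ :=
  B12RegularSpaces111Mono.unitPair_mem_space ((lam12 p).frameBox (θ.Rz p.K)) (ne_of_gt (pow_pos (inv_pos.mpr (Nat.cast_pos.mpr (F.P p.K).L_pos)) _))
    (Sect2.L_cast_ne_zero (F.P p.K)) hθ.pos.1 h₀ h₁ hα₀ ((hP.rzLaws p.K).bgI_Un_one _ _) ((hP.rzLaws p.K).bgI_Jn_one _ _)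

/-- RE-BINDING a `₁₂C` record's world by the S-binding at the six-pin view gives a record of this module with the SAME datum. [cite: Balaban1989LargeFieldII, Thm 1 p.355 (bookkeeping)] -/
theorem isRecordOfRecord₁₂CB10YZWB8B12_rebind_of_isRecordOfRecord₁₂C (h : IsRecordOfRecord₁₂C F N D w) :
    ∃ (θ : Stage12Params F N) (_ : θ.Provisos₁₂ F N), θ.Admissible F N ∧ (∀ P, w.up P = upOfRecord₅C F N (θ.toStage5₁₂ F N) P) ∧
      ∀ (lam12 : ResidB12 F N θ.τ9.M) (lam : ResidB8 θ.toStage3Params) (Mstar : ℕ) (ops : OpsY N θ.toStage3Params Mstar) (ζ : ResidZ F N) (lamW : ResidW F N),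
        IsRecordOfRecord₁₂CB10YZWB8B12 F N D { w with up := fun P => upOfRecord₅CS F N (θ.view₁₂B12B8B10YZW F N lam12 lam Mstar ops ζ lamW) P } := by
  obtain ⟨θ, hP, hθ, hD, hC, hγ, hL, hup⟩ := h
  exact ⟨θ, hP, hθ, hup, fun lam12 lam Mstar ops ζ lamW => ⟨θ, hP, lam12, lam, Mstar, ops, ζ, lamW, hθ, hD, hC, hγ, hL, fun _ => rfl⟩⟩

end Record12B12


/-! ## §3b. `IsRecordOfRecord₁₂CB10YZWB8subB12` — all six groups pinned, [B8] over the sub-index; companion; faces; OLD ⇒ NEW from the full-family record -/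

section Record12B8sub

variable (F : T4Family) (N : ℕ) [NeZero N]

/-- **«(D, w) is the record, Stage 12, all SIX typed carrier groups pinned, [B8] over the SUB-INDEX of record, `b8` surviving»**: g32's `IsRecordOfRecord₁₂CB10YZWB8B12` VERBATIM at
the six-pin view with [B8′] (residual layers quantified with the record's parameters; no law assumed beyond the sub-index's).
[cite: Balaban1985RegularSpaces, Lemma 1 – Thm 8 pp.79–101; Balaban1987RG1, Lemma 4 p.280; Balaban1989LargeFieldII, Thm 1 + (0.1) pp.355–356 (objects of record)] -/
def IsRecordOfRecord₁₂CB10YZWB8subB12 (D : FiniteEpsData F (SU N)) (w : WorldP) : Prop :=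
  ∃ (θ : Stage12Params F N) (h : θ.Provisos₁₂ F N) (lam12 : ResidB12 F N θ.τ9.M) (lam : ResidB8 θ.toStage3Params) (Mstar : ℕ) (ops : OpsY N θ.toStage3Params Mstar)
    (ζ : ResidZ F N) (lamW : ResidW F N),
    θ.Admissible F N ∧ D = datumOfRecord₁₂ F N θ h ∧ w.C = D.C ∧ (0 < w.γ ∧ w.γ ≤ θ.γ) ∧ w.L = (θ.L : ℝ) ∧
      ∀ P : B12.RunParams, w.up P = upOfRecord₅CS F N (θ.view₁₂B12B8subB10YZW F N lam12 lam Mstar ops ζ lamW) P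

/-- Inhabitation is Stage 12's exactly (all six residual types inhabited). [cite: Balaban1989LargeFieldII, Thm 1 + (0.1) pp.355–356 (bookkeeping)] -/
theorem exists_world_isRecordOfRecord₁₂CB10YZWB8subB12 (θ : Stage12Params F N) (h : θ.Provisos₁₂ F N) (hθ : θ.Admissible F N) (lam12 : ResidB12 F N θ.τ9.M)
    (lam : ResidB8 θ.toStage3Params) (Mstar : ℕ) (ops : OpsY N θ.toStage3Params Mstar) (ζ : ResidZ F N) (lamW : ResidW F N) {γw : ℝ} (hγw : 0 < γw ∧ γw ≤ θ.γ) :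
    ∃ w : WorldP, IsRecordOfRecord₁₂CB10YZWB8subB12 F N (datumOfRecord₁₂ F N θ h) w ∧ w.γ = γw := by
  obtain ⟨w₀, -, -⟩ := exists_world_isRecordOfRecord₁₂C F N θ h hθ hγw
  exact ⟨{ w₀ with
      C := (datumOfRecord₁₂ F N θ h).C, γ := γw, L := (θ.L : ℝ), one_lt_L := by exact_mod_cast θ.hL.2,
      up := fun P => upOfRecord₅CS F N (θ.view₁₂B12B8subB10YZW F N lam12 lam Mstar ops ζ lamW) P },
    ⟨θ, h, lam12, lam, Mstar, ops, ζ, lamW, hθ, rfl, rfl, hγw, rfl, fun _ => rfl⟩, rfl⟩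

variable {F N}
variable {D : FiniteEpsData F (SU N)} {w : WorldP}

/-- **THE SAME-DATUM COMPANION IN `IsRecordOfRecord₁₂CB10YZW`** (witness `(θ.pinB12 lam12).pinB8Sub lam` under the C-binding): same `D`, `C`, window, `L`; leaves agree off `b8`;
companion's `b8` (typed, over the sub-family) ⇒ record's `b8` (surviving, over the sub-family) under the carrier law (1.36) ⊂ (1.62) — never conversely.
[cite: Balaban1985RegularSpaces, Thm 8 p.101 (surviving vs typed); Balaban1989LargeFieldII, Thm 1 + (0.1) pp.355–356 (bookkeeping)] -/
theorem companion_of_isRecordOfRecord₁₂CB10YZWB8subB12 (h : IsRecordOfRecord₁₂CB10YZWB8subB12 F N D w) :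
    ∃ w' : WorldP, IsRecordOfRecord₁₂CB10YZW F N D w' ∧ w'.C = w.C ∧ w'.γ = w.γ ∧ w'.L = w.L ∧
      (∀ P : B12.RunParams, leavesP w P = { leavesP w' P with b8 := (leavesP w P).b8 }) ∧
      ∀ P : B12.RunParams, (leavesP w' P).b8 → (leavesP w P).b8 := by
  obtain ⟨θ, hP, lam12, lam, Mstar, ops, ζ, lamW, hθ, hD, hC, hγ, hL, hup⟩ := h
  have hup' : ∀ P, w.up P = (upOfRecord₅C F N (θ.view₁₂B12B8subB10YZW F N lam12 lam Mstar ops ζ lamW) P).withB8 (leavesP w P).b8 := fun P => by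
    show w.up P = (upOfRecord₅C F N _ P).withB8 (w.up P).b8
    rw [hup P]
    rfl
  refine ⟨{ w with up := fun P => upOfRecord₅C F N (θ.view₁₂B12B8subB10YZW F N lam12 lam Mstar ops ζ lamW) P },
    ⟨(θ.pinB12 F N lam12).pinB8Sub F N lam, (hP.pinB12 lam12).pinB8Sub lam, Mstar, ops, ζ, lamW,
      (Stage12Params.pinB8Sub_admissible_iff F N _ _).2 ((Stage12Params.pinB12_admissible_iff F N _ _).2 hθ), ?_, hC, hγ, hL, fun P => rfl⟩, rfl, rfl, rfl,
      leavesP_eq_of_up_withB8 hup', fun P h8 => ?_⟩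
  · rw [datumOfRecord₁₂_pinB8Sub F N (θ.pinB12 F N lam12) (hP.pinB12 lam12) lam, datumOfRecord₁₂_pinB12 F N θ hP lam12]; exact hD
  · have h8' := (upOfRecord₅C_view₁₂B8subB10YZW_b8_iff F N (θ.pinB12 F N lam12) lam Mstar ops ζ lamW P).1 h8
    show (w.up P).b8
    rw [hup P]
    exact (upOfRecord₅CS_view₁₂B12B8subB10YZW_leaves F N θ lam12 lam Mstar ops ζ lamW P).2.1.2
      (B8LeafKnitRS.b8LeafRS_of_b8LeafR (C136_C162_famB8OfRecordSub lam.β lam.len) h8')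

/-- The `₁₂C` record with the same datum at the companion world (g31's `isRecordOfRecord₁₂C_of_isRecordOfRecord₁₂CB10YZW` after the companion).
[cite: Balaban1989LargeFieldII, Thm 1 + (0.1) pp.355–356 (bookkeeping)] -/
theorem exists_isRecordOfRecord₁₂C_of_isRecordOfRecord₁₂CB10YZWB8subB12 (h : IsRecordOfRecord₁₂CB10YZWB8subB12 F N D w) :
    ∃ w' : WorldP, IsRecordOfRecord₁₂C F N D w' ∧ w'.C = w.C ∧ w'.γ = w.γ ∧ w'.L = w.L ∧
      (∀ P : B12.RunParams, leavesP w P = { leavesP w' P with b8 := (leavesP w P).b8 }) := by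
  obtain ⟨w', hw', hC, hγ, hL, hleaves, -⟩ := companion_of_isRecordOfRecord₁₂CB10YZWB8subB12 h
  exact ⟨w', isRecordOfRecord₁₂C_of_isRecordOfRecord₁₂CB10YZW hw', hC, hγ, hL, hleaves⟩

/-- **THE SIX PINNED LEAVES AT A RECORD OF THIS MODULE, for ONE parameter package**. [cite: Balaban1987RG1, Lemma 4 p.280; Balaban1985RegularSpaces, Lemma 1 – Thm 8 pp.79–101; Balaban1989LargeFieldI, Prop. 1 p.194; Balaban1985BackgroundPropagators, Thm 3.1 p.397; Balaban1985UV3, Thm 1 p.257; Balaban1985Variational, Thm 1 p.279] -/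
theorem leaves_iff_of_isRecordOfRecord₁₂CB10YZWB8subB12 (h : IsRecordOfRecord₁₂CB10YZWB8subB12 F N D w) :
    ∃ (θ : Stage12Params F N) (lam12 : ResidB12 F N θ.τ9.M) (lam : ResidB8 θ.toStage3Params) (Mstar : ℕ) (ops : OpsY N θ.toStage3Params Mstar) (ζ : ResidZ F N)
      (lamW : ResidW F N), θ.Admissible F N ∧ w.L = (θ.L : ℝ) ∧ ∀ P : B12.RunParams,
        ((leavesP w P).b12 ↔ B12LeafOfRecord₁₂ F N θ lam12 P) ∧ ((leavesP w P).b8 ↔ B8LeafOfRecordSub θ.toStage3Params lam) ∧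
        ((leavesP w P).rBasicStep ↔ B15Leaf (WOfRecord₁₂ F N θ lamW P)) ∧ ((leavesP w P).b9 ↔ B9LeafX (Y9OfRecord N θ.toStage3Params Mstar ops)) ∧
        ((leavesP w P).b10 ↔ PrintedUV3V N θ.L) ∧ ((leavesP w P).b11 ↔ B11Leaf (Z11OfRecord F N ζ)) := by
  obtain ⟨θ, -, lam12, lam, Mstar, ops, ζ, lamW, hθ, -, -, -, hL, hup⟩ := h
  refine ⟨θ, lam12, lam, Mstar, ops, ζ, lamW, hθ, hL, fun P => ?_⟩
  have hl := upOfRecord₅CS_view₁₂B12B8subB10YZW_leaves F N θ lam12 lam Mstar ops ζ lamW P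
  refine ⟨?_, ?_, ?_, ?_, ?_, ?_⟩
  · show (w.up P).b12 ↔ _
    rw [hup P]; exact hl.1
  · show (w.up P).b8 ↔ _
    rw [hup P]; exact hl.2.1
  · show (w.up P).rBasicStep ↔ _
    rw [hup P]; exact hl.2.2.1
  · show (w.up P).b9 ↔ _
    rw [hup P]; exact hl.2.2.2.1
  · show (w.up P).b10 ↔ _
    rw [hup P]; exact hl.2.2.2.2.1
  · show (w.up P).b11 ↔ _
    rw [hup P]; exact hl.2.2.2.2.2

/-- The in-edges `b4 b5 b6 b7` are THEOREMS at a record of this module (via the companion, b8-free). [cite: Balaban1983RegularityDecay, Thm p.573; Balaban1984PropagatorsI, Props. 1.1–1.2 pp.33–36; Balaban1984PropagatorsII, pp.223–250; Balaban1985Averaging, Props. 1–10 pp.26–50 (bookkeeping)] -/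
theorem b4_b5_b6_b7_of_isRecordOfRecord₁₂CB10YZWB8subB12 (h : IsRecordOfRecord₁₂CB10YZWB8subB12 F N D w) (P : B12.RunParams) :
    (leavesP w P).b4 ∧ (leavesP w P).b5 ∧ (leavesP w P).b6 ∧ (leavesP w P).b7 := by
  obtain ⟨w', hw', -, -, -, hleaves, -⟩ := companion_of_isRecordOfRecord₁₂CB10YZWB8subB12 h
  have h' : (leavesP w' P).b4 ∧ (leavesP w' P).b5 ∧ (leavesP w' P).b6 ∧ (leavesP w' P).b7 :=
    atWorld_of_isRecordOfRecord₁₂CB10YZW (X := fun ℓ => ℓ.b4 ∧ ℓ.b5 ∧ ℓ.b6 ∧ ℓ.b7)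
      (fun _ _ h5 P =>
        have h4 := b4_main_of_isRecordOfRecord₅C h5 P
        have hb5 := b5_main_of_isRecordOfRecord₅C h5 P h4
        ⟨h4, hb5, N03_at_record₅C h5 P h4 hb5, b7_main_of_isRecordOfRecord₅C h5 P hb5⟩) hw' P
  rw [hleaves P]
  exact h'

/-- **N05 ∕ N07 ∕ N08 AT A RECORD OF THIS MODULE**: N05 IS «b9 → leaf», N07 IS «leaf → b9 → b11», N08 IS «leaf → b9 → b11 → b10» (the in-edges b4–b7 are theorems).
[cite: Balaban1985RegularSpaces, Thm 2 p.83, Thm 8 p.101; Balaban1985Variational, Thm 1 p.279; Balaban1985UV3, Thm 1 p.257 (bookkeeping)] -/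
theorem b8_b11_b10_main_iff_of_isRecordOfRecord₁₂CB10YZWB8subB12 (h : IsRecordOfRecord₁₂CB10YZWB8subB12 F N D w) (P : B12.RunParams) :
    (Dag.B8_main (leavesP w P) ↔ ((leavesP w P).b9 → (leavesP w P).b8)) ∧
    (Dag.B11_main (leavesP w P) ↔ ((leavesP w P).b8 → (leavesP w P).b9 → (leavesP w P).b11)) ∧
    (Dag.B10_main (leavesP w P) ↔ ((leavesP w P).b8 → (leavesP w P).b9 → (leavesP w P).b11 → (leavesP w P).b10)) := by
  obtain ⟨-, h5, h6, h7⟩ := b4_b5_b6_b7_of_isRecordOfRecord₁₂CB10YZWB8subB12 h P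
  exact ⟨⟨fun hN h9 => hN h5 h6 h7 h9, fun hN _ _ _ => hN⟩, ⟨fun hN h8 h9 => hN h5 h6 h7 h8 h9, fun hN _ _ _ => hN⟩,
    ⟨fun hN h8 h9 h11 => hN h5 h6 h7 h8 h9 h11, fun hN _ _ _ => hN⟩⟩

/-- **N05 ∕ N07 ∕ N08 AT THE BUNDLES OF RECORD, for ONE parameter package** (the port form, `B8LeafOfRecordSub` DISPLAYED).
[cite: Balaban1985RegularSpaces, Thm 2 p.83, Thm 8 p.101; Balaban1985Variational, Thm 1 p.279; Balaban1985UV3, Thm 1 p.257 + Thm 2 p.272 (the nodes at the objects of record)] -/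
theorem nodes_iff_bundles_of_isRecordOfRecord₁₂CB10YZWB8subB12 (h : IsRecordOfRecord₁₂CB10YZWB8subB12 F N D w) :
    ∃ (θ : Stage12Params F N) (lam : ResidB8 θ.toStage3Params) (Mstar : ℕ) (ops : OpsY N θ.toStage3Params Mstar) (ζ : ResidZ F N), θ.Admissible F N ∧ w.L = (θ.L : ℝ) ∧
      ∀ P : B12.RunParams,
        (Dag.B8_main (leavesP w P) ↔ (B9LeafX (Y9OfRecord N θ.toStage3Params Mstar ops) → B8LeafOfRecordSub θ.toStage3Params lam)) ∧
        (Dag.B11_main (leavesP w P) ↔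
          (B8LeafOfRecordSub θ.toStage3Params lam → B9LeafX (Y9OfRecord N θ.toStage3Params Mstar ops) → B11Leaf (Z11OfRecord F N ζ))) ∧
        (Dag.B10_main (leavesP w P) ↔
          (B8LeafOfRecordSub θ.toStage3Params lam → B9LeafX (Y9OfRecord N θ.toStage3Params Mstar ops) → B11Leaf (Z11OfRecord F N ζ) → PrintedUV3V N θ.L)) := by
  obtain ⟨θ, lam12, lam, Mstar, ops, ζ, lamW, hθ, hL, hl⟩ := leaves_iff_of_isRecordOfRecord₁₂CB10YZWB8subB12 h
  refine ⟨θ, lam, Mstar, ops, ζ, hθ, hL, fun P => ?_⟩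
  obtain ⟨h8, h11, h10⟩ := b8_b11_b10_main_iff_of_isRecordOfRecord₁₂CB10YZWB8subB12 h P
  rw [h8, h11, h10, (hl P).2.1, (hl P).2.2.2.1, (hl P).2.2.2.2.1, (hl P).2.2.2.2.2]
  exact ⟨Iff.rfl, Iff.rfl, Iff.rfl⟩

/-- **N05 «SLOTS» FORM at a record of this module** — the closer proves the SUB-FAMILY leaf at every presenting package (through `b8LeafOfRecordSub_of_b8LeafOfRecord` from a
full-family closer such as g31's `b8LeafOfRecord_of_knit`, or directly on the sub-family where the index laws №7∕№8∕№11 are available as hypotheses `i.2`).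
[cite: Balaban1985RegularSpaces, Lemma 1 – Thm 8 pp.79–101 (the node's shape, bookkeeping)] -/
theorem b8_main_of_isRecordOfRecord₁₂CB10YZWB8subB12_of_slots (h : IsRecordOfRecord₁₂CB10YZWB8subB12 F N D w)
    (hB : ∀ (θ : Stage12Params F N) (hP : θ.Provisos₁₂ F N) (lam12 : ResidB12 F N θ.τ9.M) (lam : ResidB8 θ.toStage3Params) (Mstar : ℕ) (ops : OpsY N θ.toStage3Params Mstar)
      (ζ : ResidZ F N) (lamW : ResidW F N), θ.Admissible F N → D = datumOfRecord₁₂ F N θ hP →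
        (∀ P, w.up P = upOfRecord₅CS F N (θ.view₁₂B12B8subB10YZW F N lam12 lam Mstar ops ζ lamW) P) → B8LeafOfRecordSub θ.toStage3Params lam)
    (P : B12.RunParams) : Dag.B8_main (leavesP w P) := by
  obtain ⟨θ, hP, lam12, lam, Mstar, ops, ζ, lamW, hθ, hD, -, -, -, hup⟩ := h
  intro _ _ _ _
  show (w.up P).b8
  rw [hup P]
  exact (upOfRecord₅CS_view₁₂B12B8subB10YZW_leaves F N θ lam12 lam Mstar ops ζ lamW P).2.1.2 (hB θ hP lam12 lam Mstar ops ζ lamW hθ hD hup)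

/-- **N09's CONJUNCT 1 «SLOTS» FORM at a record of this module** (a closer supplies the companion face «displayed by-reference package ⇒ `B12LeafOfRecord₁₂`» of seat
node00-def-B12). [cite: Balaban1987RG1, Lemma 4 (3.53) p.280 (the node's conjunct 1, bookkeeping)] -/
theorem b12_leaf_of_isRecordOfRecord₁₂CB10YZWB8subB12_of_slots (h : IsRecordOfRecord₁₂CB10YZWB8subB12 F N D w)
    (hB : ∀ (θ : Stage12Params F N) (hP : θ.Provisos₁₂ F N) (lam12 : ResidB12 F N θ.τ9.M) (lam : ResidB8 θ.toStage3Params) (Mstar : ℕ) (ops : OpsY N θ.toStage3Params Mstar)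
      (ζ : ResidZ F N) (lamW : ResidW F N), θ.Admissible F N → D = datumOfRecord₁₂ F N θ hP →
        (∀ P, w.up P = upOfRecord₅CS F N (θ.view₁₂B12B8subB10YZW F N lam12 lam Mstar ops ζ lamW) P) → ∀ P, B12LeafOfRecord₁₂ F N θ lam12 P)
    (P : B12.RunParams) : (leavesP w P).b12 := by
  obtain ⟨θ, hP, lam12, lam, Mstar, ops, ζ, lamW, hθ, hD, -, -, -, hup⟩ := h
  show (w.up P).b12
  rw [hup P]
  exact (upOfRecord₅CS_view₁₂B12B8subB10YZW_leaves F N θ lam12 lam Mstar ops ζ lamW P).1.2 (hB θ hP lam12 lam Mstar ops ζ lamW hθ hD hup P)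

/-- RE-BINDING a `₁₂C` record's world by the S-binding at the six-pin view with [B8′] gives a record of this module with the SAME datum. [cite: Balaban1989LargeFieldII, Thm 1 p.355 (bookkeeping)] -/
theorem isRecordOfRecord₁₂CB10YZWB8subB12_rebind_of_isRecordOfRecord₁₂C (h : IsRecordOfRecord₁₂C F N D w) :
    ∃ (θ : Stage12Params F N) (_ : θ.Provisos₁₂ F N), θ.Admissible F N ∧ (∀ P, w.up P = upOfRecord₅C F N (θ.toStage5₁₂ F N) P) ∧
      ∀ (lam12 : ResidB12 F N θ.τ9.M) (lam : ResidB8 θ.toStage3Params) (Mstar : ℕ) (ops : OpsY N θ.toStage3Params Mstar) (ζ : ResidZ F N) (lamW : ResidW F N),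
        IsRecordOfRecord₁₂CB10YZWB8subB12 F N D { w with up := fun P => upOfRecord₅CS F N (θ.view₁₂B12B8subB10YZW F N lam12 lam Mstar ops ζ lamW) P } := by
  obtain ⟨θ, hP, hθ, hD, hC, hγ, hL, hup⟩ := h
  exact ⟨θ, hP, hθ, hup, fun lam12 lam Mstar ops ζ lamW => ⟨θ, hP, lam12, lam, Mstar, ops, ζ, lamW, hθ, hD, hC, hγ, hL, fun _ => rfl⟩⟩

/-- **OLD ⇒ NEW AT THE RECORD LEVEL**: a full-family record (`IsRecordOfRecord₁₂CB10YZWB8B12`, g32) gives the sub-family record WITH THE SAME DATUM at the re-keyed world — same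
`C`, window, `L`; the leaves `b12`, `rBasicStep`, `b9`, `b10`, `b11`, `b4`–`b7`, `b13`, `rOperation` are EQUAL and the new `b8` is IMPLIED by the old one
(`b8LeafOfRecordSub_of_b8LeafOfRecord`). [cite: Balaban1985RegularSpaces, Lemma 1 – Thm 8 pp.79–101 (restriction of the family index); Balaban1989LargeFieldII, Thm 1 p.355 (bookkeeping)] -/
theorem exists_isRecordOfRecord₁₂CB10YZWB8subB12_of_isRecordOfRecord₁₂CB10YZWB8B12 (h : IsRecordOfRecord₁₂CB10YZWB8B12 F N D w) :
    ∃ w' : WorldP, IsRecordOfRecord₁₂CB10YZWB8subB12 F N D w' ∧ w'.C = w.C ∧ w'.γ = w.γ ∧ w'.L = w.L ∧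
      (∀ P : B12.RunParams, leavesP w' P = { leavesP w P with b8 := (leavesP w' P).b8 }) ∧
      ∀ P : B12.RunParams, (leavesP w P).b8 → (leavesP w' P).b8 := by
  obtain ⟨θ, hP, lam12, lam, Mstar, ops, ζ, lamW, hθ, hD, hC, hγ, hL, hup⟩ := h
  refine ⟨{ w with up := fun P => upOfRecord₅CS F N (θ.view₁₂B12B8subB10YZW F N lam12 lam Mstar ops ζ lamW) P },
    ⟨θ, hP, lam12, lam, Mstar, ops, ζ, lamW, hθ, hD, hC, hγ, hL, fun _ => rfl⟩, rfl, rfl, rfl, fun P => ?_, fun P h8 => ?_⟩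
  · have hup' : ∀ P, upOfRecord₅CS F N (θ.view₁₂B12B8subB10YZW F N lam12 lam Mstar ops ζ lamW) P =
        (w.up P).withB8 (upOfRecord₅CS F N (θ.view₁₂B12B8subB10YZW F N lam12 lam Mstar ops ζ lamW) P).b8 := fun P => by
      rw [hup P]; rfl
    exact leavesP_eq_of_up_withB8 (w := { w with up := fun P => upOfRecord₅CS F N (θ.view₁₂B12B8subB10YZW F N lam12 lam Mstar ops ζ lamW) P })
      (u := w.up) hup' P
  · have h8' : B8LeafOfRecord θ.toStage3Params lam := by
      have h8w : (w.up P).b8 := h8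
      rw [hup P] at h8w
      exact (upOfRecord₅CS_view₁₂B12B8B10YZW_leaves F N θ lam12 lam Mstar ops ζ lamW P).2.1.1 h8w
    show (upOfRecord₅CS F N (θ.view₁₂B12B8subB10YZW F N lam12 lam Mstar ops ζ lamW) P).b8
    exact (upOfRecord₅CS_view₁₂B12B8subB10YZW_leaves F N θ lam12 lam Mstar ops ζ lamW P).2.1.2 (b8LeafOfRecordSub_of_b8LeafOfRecord lam h8')

end Record12B8sub

end Literature.MathematicalPhysics.QuantumFieldTheory.Balaban1983to89.Node00

end
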